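import Literature.NumberTheory.Sieve.MaynardNFPushforward
import Literature.NumberTheory.Sieve.IdealSieveSumsSharp
import HarnessLib

/-!
# The Maynard–Tao sieve over `𝓞_K`: the main-term evaluation (equidistribution over `𝓞_K`)

Topic `Literature/NumberTheory/Sieve`. A. Castillo, C. Hall, R. J. Lemke Oliver, P. Pollack,
L. Thompson, *Bounded gaps between primes in number fields and function fields*, Proc. AMS 143 (2015)
= arXiv:1403.5808, proof of Proposition 2.1: "the proof of this result follows from exactly the same
reasoning as Maynard's proofs of Lemmas 6.1 and 6.2 … our Lemma 2.5 replaces his Lemma 6.1" — i.e.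
the evaluation of `∑_{𝔲₁,…,𝔲_k} (∏ᵢ μ²1_{(𝔲ᵢ,𝔴)=1}/φ(𝔲ᵢ)) G(log N𝔲ᵢ/log R)` as
`(c_K φ(𝔴)/N𝔴 · log R)^k (∫_{[0,1]^k} G + o(1))`. The tree proves Maynard's Lemmas 6.2/6.3 main
terms by a `k`-dimensional Riemann-sum argument needing only the one-dimensional COUNTING FUNCTIONS
(`MaynardTao.abs_weightedSum_sub_integral_le`, `MaynardEquidistribution.lean`); by
`MaynardNFPushforward.sum_piFinset_G1_eq_weightedSum` the number-field sums are such weighted sums,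
and `IdealSieveSumsSharp.abs_sum_inv_totientIdeal_sub_sharp` supplies the counting function. This
file PROVES the resulting explicit estimate:

* **`abs_sum_piFinset_G1_sub_integral_le`** — for `𝔴 ≠ 0`, `D₀ ≥ 1` with every prime of norm
  `≤ D₀` dividing `𝔴`, `R > 1`, a mesh `M ≥ 1`, and `G = g · 1_P` (`P` a polytope of simplex type,
  `g` continuous on the cube with modulus `ω` at scale `1/M` and bound `Gmax`):
  `|∑_{𝔲 ∈ G1^k} (∏ᵢ 1/φ(𝔲ᵢ)) G((log N𝔲ᵢ/log R)ᵢ) − (c log R)^k ∫_{[0,1]^k} G| ≤ (c log R)^k · B(M, ω, η)`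
  with `c = c_K φ(𝔴)/N𝔴`, `η = 2M(ε + E/(c log R))`, `ε = e^{5Z} D₀^{-1/4} N𝔴/φ(𝔴)`,
  `E = e^{5Z}(E_C(𝔴) + 4c_K)` — the constants of `IdealSieveSumsSharp` (passed as `d, c, ε, E` with
  their defining equations, to be instantiated by `rfl`).

## References

* Castillo–Hall–Lemke Oliver–Pollack–Thompson, arXiv:1403.5808, Lemma 2.5 and the proof of
  Proposition 2.1. [CastilloEtAl2015]
* J. Maynard, *Small gaps between primes*, Ann. of Math. 181 (2015), Lemmas 6.1–6.3.
  [MaynardAnnals2015]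
-/

noncomputable section

open Finset UniqueFactorizationMonoid NumberField MeasureTheory
open scoped NumberField Classical

namespace Literature.NumberTheory.Sieve.MaynardNF

open Literature.NumberTheory.LFunctions Literature.NumberTheory.LFunctions.NumberField
  Literature.NumberTheory.Sieve.MaynardTao Literature.NumberTheory.Sieve.IdealSieve

variable {K : Type*} [Field K] [NumberField K]
variable {k : ℕ} {ι : Type*} [Fintype ι]

/-- **The main-term evaluation over `𝓞_K`** (Castillo et al., proof of Proposition 2.1 via Lemma 2.5;
here through the tree's `k`-dimensional equidistribution theorem): with `C, Z` the constants of
`IdealSieveSumsSharp.abs_sum_inv_totientIdeal_sub_sharp`, `d = φ(𝔴)/N𝔴 = ∑_{𝔢∣𝔴} μ(𝔢)/N𝔢`,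
`c = c_K d`, `ε = e^{5Z} D₀^{-1/4}/d`, `E = e^{5Z}(E_C(𝔴) + 4c_K)`, for every polytope `P` of simplex
type and `g` continuous on the cube,
`|∑_{𝔲 ∈ G1^k} (∏ᵢ 1/φ(𝔲ᵢ)) (1_P g)((log N𝔲ᵢ/log R)ᵢ) − (c log R)^k ∫_{[0,1]^k} 1_P g|
 ≤ (c log R)^k (((1+η)^k + 1)(ω + 2 Gmax L'/M) + Gmax((1+η)^k − 1))`, `η = 2M(ε + E/(c log R))`.
[cite: CastilloEtAl2015, Lemma 2.5 and proof of Proposition 2.1] -/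
theorem abs_sum_piFinset_G1_sub_integral_le (hk : 0 < k) {C Z : ℝ} (hC0 : 0 ≤ C)
    (hsharp : ∀ (𝔴 : Ideal (𝓞 K)), 𝔴 ≠ ⊥ → ∀ D₀ : ℝ, 1 ≤ D₀ →
      (∀ P : Ideal (𝓞 K), Prime P → (Ideal.absNorm P : ℝ) ≤ D₀ → P ∣ 𝔴) → ∀ x : ℝ, 1 ≤ x →
      |∑ 𝔲 ∈ (idealsLE K x).filter (fun 𝔲 => 𝔲 ⊔ 𝔴 = ⊤ ∧ Squarefree 𝔲),
          ∏ P ∈ (normalizedFactors 𝔲).toFinset, 1 / ((Ideal.absNorm P : ℝ) - 1) -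
          dedekindZeta_residue K *
            (∑ 𝔢 ∈ idealDivisors K 𝔴, (idealMoebius 𝔢 : ℝ) / Ideal.absNorm 𝔢) * Real.log x| ≤
        Real.exp (5 * Z) *
          ((∑ 𝔢 ∈ idealDivisors K 𝔴,
              (C + dedekindZeta_residue K * Real.log (Ideal.absNorm 𝔢)) / Ideal.absNorm 𝔢) +
            4 * dedekindZeta_residue K +
            dedekindZeta_residue K * D₀ ^ (-(1 : ℝ) / 4) * Real.log x))
    {𝔴 : Ideal (𝓞 K)} (h𝔴 : 𝔴 ≠ ⊥) {D₀ : ℝ} (hD₀ : 1 ≤ D₀)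
    (hD : ∀ P : Ideal (𝓞 K), Prime P → (Ideal.absNorm P : ℝ) ≤ D₀ → P ∣ 𝔴)
    {R : ℝ} (hR : 1 < R) {M : ℕ} (hM : 0 < M) (S : ι → Finset (Fin k))
    {g : (Fin k → ℝ) → ℝ} {ω Gmax : ℝ} (hω : 0 ≤ ω) (hGmax : 0 ≤ Gmax)
    (hcont : ∀ t ∈ maynardCube k, ∀ t' ∈ maynardCube k, (∀ i, |t i - t' i| ≤ 1 / (M : ℝ)) → |g t - g t'| ≤ ω)
    (hgb : ∀ t ∈ maynardCube k, |g t| ≤ Gmax)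
    (hint : IntegrableOn ((polytope S).indicator g) (maynardCube k) volume)
    {d c ε E : ℝ} (hd : d = ∑ 𝔢 ∈ idealDivisors K 𝔴, (idealMoebius 𝔢 : ℝ) / Ideal.absNorm 𝔢)
    (hc : c = dedekindZeta_residue K * d) (hε : ε = Real.exp (5 * Z) * D₀ ^ (-(1 : ℝ) / 4) / d)
    (hE : E = Real.exp (5 * Z) * ((∑ 𝔢 ∈ idealDivisors K 𝔴,
        (C + dedekindZeta_residue K * Real.log (Ideal.absNorm 𝔢)) / Ideal.absNorm 𝔢) +
          4 * dedekindZeta_residue K)) :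
    |∑ 𝔲 ∈ Fintype.piFinset (fun _ : Fin k => G1 K 𝔴 R),
        (∏ i, 1 / idealTotient K (𝔲 i)) *
          (polytope S).indicator g (fun i => Real.log (Ideal.absNorm (𝔲 i)) / Real.log R) -
        (c * Real.log R) ^ k * ∫ t in maynardCube k, (polytope S).indicator g t| ≤
      (c * Real.log R) ^ k *
        (((1 + 2 * M * (ε + E / (c * Real.log R))) ^ k + 1) *
            (ω + 2 * Gmax * (∑ l, ((S l).card + 1 : ℝ)) / M) +
          Gmax * ((1 + 2 * M * (ε + E / (c * Real.log R))) ^ k - 1)) := by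
  -- `d > 0`, `c > 0`
  have hd0 : 0 < d := by
    rw [hd, dsum_eq_prod_one_sub_inv h𝔴]
    refine Finset.prod_pos fun P hP => ?_
    have h2 : (2 : ℝ) ≤ Ideal.absNorm P := by
      exact_mod_cast two_le_absNorm_of_prime (prime_of_normalized_factor P (Multiset.mem_toFinset.1 hP))
    have : 1 / (Ideal.absNorm P : ℝ) ≤ 1 / 2 := one_div_le_one_div_of_le (by norm_num) h2
    linarith
  have hρ0 : 0 < dedekindZeta_residue K := dedekindZeta_residue_pos K
  have hc0 : 0 < c := by rw [hc]; exact mul_pos hρ0 hd0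
  have hε0 : 0 ≤ ε := by rw [hε]; positivity
  have hEC0 : 0 ≤ ∑ 𝔢 ∈ idealDivisors K 𝔴,
      (C + dedekindZeta_residue K * Real.log (Ideal.absNorm 𝔢)) / Ideal.absNorm 𝔢 := by
    refine Finset.sum_nonneg fun 𝔢 h𝔢 => div_nonneg (add_nonneg hC0 (mul_nonneg hρ0.le
      (Real.log_nonneg ?_))) (Nat.cast_nonneg _)
    exact_mod_cast Nat.one_le_iff_ne_zero.2 (by
      rw [Ne, Ideal.absNorm_eq_zero_iff]; exact ne_bot_of_mem_idealDivisors h𝔴 h𝔢)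
  have hE0 : 0 ≤ E := by rw [hE]; positivity
  -- the counting function of `normWeight`
  have hH : ∀ y : ℝ, 1 ≤ y → |massUpTo (normWeight K 𝔴) ⌊y⌋₊ - c * Real.log y| ≤
      ε * c * Real.log y + E := by
    intro y hy
    rw [massUpTo_normWeight_eq, hc]
    have h := hsharp 𝔴 h𝔴 D₀ hD₀ hD y hy
    rw [← hd] at h
    have hεc : ε * (dedekindZeta_residue K * d) =
        Real.exp (5 * Z) * D₀ ^ (-(1 : ℝ) / 4) * dedekindZeta_residue K := by
      rw [hε]; field_simp
    rw [hεc, hE]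
    refine h.trans (le_of_eq ?_)
    ring
  -- the pushforward and the equidistribution theorem
  rw [sum_piFinset_G1_eq_weightedSum]
  exact abs_weightedSum_sub_integral_le hk S (wt := fun _ => normWeight K 𝔴)
    (fun _ u => normWeight_nonneg 𝔴 u) hc0 hε0 hE0 (fun _ => hH) hR hM hω hGmax hcont hgb hint

end Literature.NumberTheory.Sieve.MaynardNF
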